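import Summits.Ventures.PercRepro.S2MaxExtension

/-!
# PercRepro — S2: A CIRCUIT OUTSIDE A SET RAISES THE NULLITY (p7, gen 14; sub-claim S2; Lemma U of the spread case of `(14, 7)`)

Adding a circuit `C ⊄ A` to a set `A` raises the nullity `|·| − ρ(·)` by at least one: the last point `c ∈ C ∖ A` lies in the
closure of the rest (**`eRk_union_add_ncard_add_one_le`**). Hence two distinct circuits have a union of nullity `≥ 2` and, with a
third circuit not inside that union, of nullity `≥ 3` (**`eRk_union_three_add_three_le_encard`**) — the sets the nullity lever
(`S2.nullity_lever_top_six`) wants. Axioms: standard.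
-/

open scoped Matroid

namespace PercRepro

namespace S2

open Set

variable {α : Type}

/-- **A circuit not inside `A` raises the nullity**: `ρ(A ∪ C) + |A| + 1 ≤ ρ(A) + |A ∪ C|`. -/
theorem eRk_union_add_ncard_add_one_le (M : Matroid α) [M.Finite] {A C : Set α} (hA : A ⊆ M.E)
    (hC : M.IsCircuit C) (hCA : ¬ C ⊆ A) :
    M.eRk (A ∪ C) + A.ncard + 1 ≤ M.eRk A + (A ∪ C).ncard := by
  have hAfin : A.Finite := M.ground_finite.subset hA
  have hCfin : C.Finite := M.ground_finite.subset hC.subset_ground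
  obtain ⟨c, hcC, hcA⟩ := Set.not_subset.1 hCA
  -- `ρ(A ∪ C) ≤ ρ(A ∪ (C ∖ {c}))`
  have h1 : M.eRk (A ∪ C) ≤ M.eRk (A ∪ (C \ {c})) := by
    rw [← M.eRk_union_closure_right_eq A (C \ {c})]
    exact M.eRk_mono (Set.union_subset_union_right A (hC.subset_closure_sdiff_singleton c))
  -- `ρ(A ∪ (C ∖ {c})) ≤ ρ(A) + |(C ∖ {c}) ∖ A|`
  have h2 := M.eRk_union_le_eRk_add_encard A ((C \ {c}) \ A)
  rw [Set.union_sdiff_self, ← ((hCfin.subset Set.sdiff_subset).subset Set.sdiff_subset).cast_ncard_eq] at h2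
  -- the sizes: `|A ∪ C| = |A| + |(C ∖ {c}) ∖ A| + 1`
  have hsize : (A ∪ C).ncard = A.ncard + ((C \ {c}) \ A).ncard + 1 := by
    have e1 : (A ∪ C).ncard = A.ncard + (C \ A).ncard := by
      rw [← Set.ncard_union_eq Set.disjoint_sdiff_right hAfin (hCfin.subset Set.sdiff_subset), Set.union_sdiff_self]
    have e2 : ((C \ A) \ {c}).ncard + 1 = (C \ A).ncard :=
      Set.ncard_sdiff_singleton_add_one ⟨hcC, hcA⟩ (hCfin.subset Set.sdiff_subset)
    have e3 : (C \ A) \ {c} = (C \ {c}) \ A := Set.sdiff_sdiff_comm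
    rw [e3] at e2
    omega
  obtain ⟨r, hr⟩ := ENat.ne_top_iff_exists.1 (eRk_ne_top_of_finite (M := M) hA)
  obtain ⟨r', hr'⟩ := ENat.ne_top_iff_exists.1 (eRk_ne_top_of_finite (M := M) (Set.union_subset hA hC.subset_ground))
  obtain ⟨r'', hr''⟩ := ENat.ne_top_iff_exists.1
    (eRk_ne_top_of_finite (M := M) (Set.union_subset hA (Set.sdiff_subset.trans hC.subset_ground)))
  rw [← hr', ← hr''] at h1
  rw [← hr'', ← hr] at h2
  rw [← hr', ← hr, hsize]
  have h1' : r' ≤ r'' := by exact_mod_cast h1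
  have h2' : r'' ≤ r + ((C \ {c}) \ A).ncard := by exact_mod_cast h2
  have : r' + A.ncard + 1 ≤ r + (A.ncard + ((C \ {c}) \ A).ncard + 1) := by omega
  exact_mod_cast this

/-- **Two distinct circuits have a union of nullity `≥ 2`**: `ρ(C₁ ∪ C₂) + 2 ≤ |C₁ ∪ C₂|`. -/
theorem eRk_union_two_add_two_le_encard (M : Matroid α) [M.Finite] {C₁ C₂ : Set α}
    (h₁ : M.IsCircuit C₁) (h₂ : M.IsCircuit C₂) (h12 : C₁ ≠ C₂) :
    M.eRk (C₁ ∪ C₂) + 2 ≤ (C₁ ∪ C₂).encard := by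
  have h₁fin : C₁.Finite := M.ground_finite.subset h₁.subset_ground
  have hC₂ : ¬ C₂ ⊆ C₁ := fun h => h12 (h₂.eq_of_subset_isCircuit h₁ h).symm
  have hstep := eRk_union_add_ncard_add_one_le M h₁.subset_ground h₂ hC₂
  have hr₁ := h₁.eRk_add_one_eq
  rw [← h₁fin.cast_ncard_eq] at hr₁
  rw [← (h₁fin.union (M.ground_finite.subset h₂.subset_ground)).cast_ncard_eq]
  obtain ⟨r, hr⟩ := ENat.ne_top_iff_exists.1 (eRk_ne_top_of_finite (M := M) h₁.subset_ground)
  obtain ⟨r', hr'⟩ := ENat.ne_top_iff_exists.1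
    (eRk_ne_top_of_finite (M := M) (Set.union_subset h₁.subset_ground h₂.subset_ground))
  rw [← hr, ← hr'] at hstep
  rw [← hr] at hr₁
  rw [← hr']
  have e1 : r + 1 = C₁.ncard := by exact_mod_cast hr₁
  have e2 : r' + C₁.ncard + 1 ≤ r + (C₁ ∪ C₂).ncard := by exact_mod_cast hstep
  have : r' + 2 ≤ (C₁ ∪ C₂).ncard := by omega
  exact_mod_cast this

/-- **Lemma U: three circuits, the third not inside the union of the first two, have a union of nullity `≥ 3`.** -/
theorem eRk_union_three_add_three_le_encard (M : Matroid α) [M.Finite] {C₁ C₂ C₃ : Set α}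
    (h₁ : M.IsCircuit C₁) (h₂ : M.IsCircuit C₂) (h₃ : M.IsCircuit C₃) (h12 : C₁ ≠ C₂) (h3 : ¬ C₃ ⊆ C₁ ∪ C₂) :
    M.eRk (C₁ ∪ C₂ ∪ C₃) + 3 ≤ (C₁ ∪ C₂ ∪ C₃).encard := by
  have hUfin : (C₁ ∪ C₂).Finite :=
    (M.ground_finite.subset h₁.subset_ground).union (M.ground_finite.subset h₂.subset_ground)
  have hUE : C₁ ∪ C₂ ⊆ M.E := Set.union_subset h₁.subset_ground h₂.subset_ground
  have htwo := eRk_union_two_add_two_le_encard M h₁ h₂ h12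
  have hstep := eRk_union_add_ncard_add_one_le M hUE h₃ h3
  rw [← hUfin.cast_ncard_eq] at htwo
  rw [← (hUfin.union (M.ground_finite.subset h₃.subset_ground)).cast_ncard_eq]
  obtain ⟨r, hr⟩ := ENat.ne_top_iff_exists.1 (eRk_ne_top_of_finite (M := M) hUE)
  obtain ⟨r', hr'⟩ := ENat.ne_top_iff_exists.1
    (eRk_ne_top_of_finite (M := M) (Set.union_subset hUE h₃.subset_ground))
  rw [← hr] at htwo
  rw [← hr, ← hr'] at hstep
  rw [← hr']
  have e1 : r + 2 ≤ (C₁ ∪ C₂).ncard := by exact_mod_cast htwo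
  have e2 : r' + (C₁ ∪ C₂).ncard + 1 ≤ r + (C₁ ∪ C₂ ∪ C₃).ncard := by exact_mod_cast hstep
  have : r' + 3 ≤ (C₁ ∪ C₂ ∪ C₃).ncard := by omega
  exact_mod_cast this

end S2

end PercRepro
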